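import Mathlib
import Summits.ResolutionOfSingularities.ResolutionOfSingularities.Theorems.PAlterationPicoverToRadicialBottomFrobenius
import Summits.ResolutionOfSingularities.ResolutionOfSingularities.Theorems.PAlterationAssemblyRadicialSections

/-!
# `PAlteration.PicoverToRadicialBottom`: the Frobenius factor of a finite radicial cover

Route `ResolutionOfSingularities/pAlteration`, crux `PicoverToRadicialBottom`
(stmt-ResolutionOfSingularities-0556), line `theta-finite-cofinite-roots`, stub
`stub_frobeniusFactor`; helper file (`--supports`).

**Theorem** (`stub_frobeniusFactor`). Let `g : X'' ⟶ X` be a finite, universally injective,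
surjective morphism of integral schemes, with `X` quasi-compact and normal (all local rings
integrally closed) and `p = 0` in `Γ(X, 𝒪_X)`. Then for some `r` the `pʳ`-th power endomorphism
`F = powEndo X (p ^ r)` (identity on points, `s ↦ s^{pʳ}` on functions) factors through `g`:
there is `h : X ⟶ X''` with `h ≫ g = F` (Kollár 1997, §6; Stacks 0CCB).

Proof.
* `hom_eq_of_comp_eq_of_universallyInjective`: morphisms from a reduced scheme to `X''` are
  determined by their composite with `g` (`g` is radicial and separated: compare on residue
  fields, Mathlib `ext_of_fromSpecResidueField_eq`, Stacks 01S4);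
* `exists_frobeniusFactor_app_of_le`: over a non-empty affine open `U = Spec A ⊆ X`,
  `g⁻¹U = Spec C` and the `p^M`-th power map of `C` factors through `A` for all large `M`
  (`exists_frobeniusFactor_app`, raised to higher exponents by composing with Frobenius);
* `isoSpec_SpecMap_comp_eq`: the resulting morphism `U ≅ Spec A → Spec C ≅ g⁻¹U ⊆ X''` lies
  over `F`;
* `stub_frobeniusFactor`: finitely many such `U` cover `X`; take a common exponent `r` and glue
  (`Scheme.Cover.glueMorphisms`), compatibility on overlaps being forced by uniqueness.
-/

noncomputable section

-- single-problem summit: the doubled namespace component `ResolutionOfSingularities` is forced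
set_option linter.dupNamespace false

open CategoryTheory CategoryTheory.Limits AlgebraicGeometry TopologicalSpace Opposite
open Literature.AlgebraicGeometry.Motives

namespace Summit.ResolutionOfSingularities.ResolutionOfSingularities.Theorems

/-! ## Uniqueness of lifts along a radicial separated morphism -/

/-- **Morphisms from a reduced scheme into the source of a universally injective separated
morphism `g` are determined by their composite with `g`**: two such morphisms agree on every
residue field (a radicial morphism is injective on `K`-points, Stacks 01S4) and over `g`, hence
are equal (Mathlib `ext_of_fromSpecResidueField_eq`). [folklore] -/
theorem hom_eq_of_comp_eq_of_universallyInjective {W X'' X : Scheme.{0}} [IsReduced W]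
    (g : X'' ⟶ X) [UniversallyInjective g] [IsSeparated g] {a b : W ⟶ X''}
    (h : a ≫ g = b ≫ g) : a = b := by
  refine ext_of_fromSpecResidueField_eq a b g Set.univ dense_univ (fun x _ => ?_) h
  have hUI : ∀ (K : Type) [Field K],
      Function.Injective (fun s : Spec (.of K) ⟶ X'' => s ≫ g) :=
    ((tfae_universallyInjective g).out 0 1).mp ‹_›
  exact hUI (W.residueField x) (by simp only [Category.assoc, h])

/-! ## Finite affine covers -/

/-- A quasi-compact scheme is covered by finitely many non-empty affine opens. [folklore] -/
theorem exists_finset_isOpenCover_nonempty_affineOpens (X : Scheme.{0}) [CompactSpace X] :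
    ∃ t : Finset {U : X.affineOpens // Nonempty (U : X.Opens)},
      IsOpenCover fun i : t =>
        ((i : {U : X.affineOpens // Nonempty (U : X.Opens)}).1 : X.Opens) := by
  obtain ⟨t, ht⟩ := isCompact_univ.elim_finite_subcover
    (fun U : {U : X.affineOpens // Nonempty (U : X.Opens)} => ((U.1 : X.Opens) : Set X))
    (fun U => (U.1 : X.Opens).isOpen) (by
      intro x _
      obtain ⟨_, ⟨U, hU, rfl⟩, hxU, -⟩ :=
        X.isBasis_affineOpens.exists_subset_of_mem_open (Set.mem_univ x) isOpen_univ
      exact Set.mem_iUnion.mpr ⟨⟨⟨U, hU⟩, ⟨⟨x, hxU⟩⟩⟩, hxU⟩)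
  refine ⟨t, top_le_iff.mp fun x _ => ?_⟩
  have hx := ht (Set.mem_univ x)
  simp only [Set.mem_iUnion] at hx
  obtain ⟨U, hU, hxU⟩ := hx
  exact Opens.mem_iSup.mpr ⟨⟨U, hU⟩, hxU⟩

/-! ## The affine pieces -/

section Local

variable (p : ℕ) [hp : Fact p.Prime] {X X'' : Scheme.{0}} [IsIntegral X] [IsIntegral X'']
  (g : X'' ⟶ X) [IsFinite g] [UniversallyInjective g] [Surjective g]

omit [IsIntegral X] [IsIntegral X''] [IsFinite g] [UniversallyInjective g] in
/-- The preimage of a non-empty open under a surjective morphism is non-empty. [folklore] -/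
theorem nonempty_preimage_of_surjective (U : X.Opens) [hU : Nonempty U] :
    Nonempty (g ⁻¹ᵁ U : X''.Opens) := by
  obtain ⟨⟨x, hx⟩⟩ := hU
  obtain ⟨y, rfl⟩ := g.surjective x
  exact ⟨⟨y, hx⟩⟩

/-- **The local Frobenius factors, with exponents raised at will.** Over a non-empty affine
open `U = Spec A` of the normal integral `X` (characteristic `p`), with `g⁻¹U = Spec C`, for
every large `M` there is a ring map `σ : C → A` with `g^* ∘ σ = Frob^M` and `σ ∘ g^* = Frob^M`
(`exists_frobeniusFactor_app`, composed with further Frobenius powers of `A`). [folklore] -/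
theorem exists_frobeniusFactor_app_of_le (hN : ∀ x : X, IsIntegrallyClosed (X.presheaf.stalk x))
    (hX : (p : Γ(X, ⊤)) = 0) (U : X.Opens) (hU : IsAffineOpen U) [Nonempty U] :
    ∃ N : ℕ, ∀ M, N ≤ M → ∃ σ : Γ(X'', g ⁻¹ᵁ U) →+* Γ(X, U),
      (∀ c, g.app U (σ c) = c ^ p ^ M) ∧ ∀ a, σ (g.app U a) = a ^ p ^ M := by
  haveI : Nonempty (g ⁻¹ᵁ U : X''.Opens) := nonempty_preimage_of_surjective g U
  obtain ⟨N, σ, h1, h2⟩ := exists_frobeniusFactor_app g hN p hX U hU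
  have hpA : (p : Γ(X, U)) = 0 := natCast_sections_eq_zero X p hX U
  refine ⟨N, fun M hM => ?_⟩
  have hpN : p ^ (M - N) ≠ 0 := pow_ne_zero _ hp.out.ne_zero
  refine ⟨(powRingHom Γ(X, U) (p ^ (M - N)) hpN
    (add_pow_prime_pow_of_natCast_eq_zero p hpA (M - N))).comp σ, fun c => ?_, fun a => ?_⟩
  · change g.app U ((σ c) ^ p ^ (M - N)) = _
    rw [map_pow, h1, ← pow_mul, ← pow_add, Nat.add_sub_cancel' hM]
  · change (σ (g.app U a)) ^ p ^ (M - N) = _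
    rw [h2, ← pow_mul, ← pow_add, Nat.add_sub_cancel' hM]

/-- `powEndo_Spec` for a bundled ring `R : CommRingCat`: the power endomorphism of `Spec R` is
`Spec` of the power map of `R`. [folklore] -/
theorem powEndo_Spec_of (R : CommRingCat.{0}) (n : ℕ) (hn : n ≠ 0)
    (haddR : ∀ a b : R, (a + b) ^ n = a ^ n + b ^ n)
    (hadd' : ∀ (U : (Spec R).Opens) (a b : Γ(Spec R, U)), (a + b) ^ n = a ^ n + b ^ n) :
    powEndo (Spec R) n hn hadd' = Spec.map (CommRingCat.ofHom (powRingHom R n hn haddR)) :=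
  powEndo_Spec n hn R haddR hadd'

omit [IsIntegral X] [IsIntegral X''] [IsFinite g] [UniversallyInjective g] [Surjective g] in
/-- **The affine piece of the Frobenius factor lies over `F`.** For an affine open `U = Spec A`
with `g⁻¹U = Spec C` and a ring map `σ : C → A` with `σ ∘ g^* = (a ↦ a^{pʳ})`, the morphism
`U ≅ Spec A → Spec C ≅ g⁻¹U ⊆ X''` composed with `g` is `U ⊆ X` followed by the `pʳ`-th power
endomorphism of `X`. [folklore] -/
theorem isoSpec_SpecMap_comp_eq [IsAffineHom g] (hX : (p : Γ(X, ⊤)) = 0) (r : ℕ) (U : X.Opens)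
    (hU : IsAffineOpen U) (σ : Γ(X'', g ⁻¹ᵁ U) →+* Γ(X, U))
    (hσ : ∀ a, σ (g.app U a) = a ^ p ^ r) :
    (hU.isoSpec.hom ≫ Spec.map (CommRingCat.ofHom σ) ≫ (hU.preimage g).isoSpec.inv ≫
      (g ⁻¹ᵁ U).ι) ≫ g =
      U.ι ≫ powEndo X (p ^ r) (pow_ne_zero r hp.out.ne_zero)
        (add_pow_prime_pow_sections X p hX r) := by
  have hpr : p ^ r ≠ 0 := pow_ne_zero r hp.out.ne_zero
  -- characteristic `p` on `U` and on `Spec Γ(X, U)`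
  have hU0 : (p : Γ(U, ⊤)) = 0 := by
    rw [← map_natCast U.ι.appTop.hom p, hX, map_zero]
  have hS0 : (p : Γ(Spec Γ(X, U), ⊤)) = 0 := by
    rw [← map_natCast hU.isoSpec.inv.appTop.hom p, hU0, map_zero]
  have haddA : ∀ a b : Γ(X, U), (a + b) ^ p ^ r = a ^ p ^ r + b ^ p ^ r :=
    add_pow_prime_pow_sections X p hX r U
  have hring : g.app U ≫ CommRingCat.ofHom σ =
      CommRingCat.ofHom (powRingHom Γ(X, U) (p ^ r) hpr haddA) := by
    ext a
    simp only [CommRingCat.hom_comp, CommRingCat.hom_ofHom, RingHom.comp_apply, powRingHom_apply]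
    exact hσ a
  calc (hU.isoSpec.hom ≫ Spec.map (CommRingCat.ofHom σ) ≫ (hU.preimage g).isoSpec.inv ≫
      (g ⁻¹ᵁ U).ι) ≫ g
      = hU.isoSpec.hom ≫ Spec.map (CommRingCat.ofHom σ) ≫ (hU.preimage g).fromSpec ≫ g := by
        simp only [Category.assoc, IsAffineOpen.isoSpec_inv_ι_assoc]
    _ = hU.isoSpec.hom ≫ Spec.map (g.app U ≫ CommRingCat.ofHom σ) ≫ hU.fromSpec := by
        rw [← IsAffineOpen.SpecMap_appLE_fromSpec g hU (hU.preimage g) le_rfl,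
          ← Scheme.Hom.app_eq_appLE, Spec.map_comp]
        simp only [Category.assoc]
    _ = hU.isoSpec.hom ≫ powEndo (Spec Γ(X, U)) (p ^ r) hpr
          (add_pow_prime_pow_sections _ p hS0 r) ≫ hU.fromSpec := by
        rw [hring, powEndo_Spec_of Γ(X, U) (p ^ r) hpr haddA]
    _ = powEndo (U : Scheme.{0}) (p ^ r) hpr (add_pow_prime_pow_sections _ p hU0 r) ≫
          hU.isoSpec.hom ≫ hU.fromSpec := by
        rw [← Category.assoc,
          ← powEndo_comp (p ^ r) hpr _ hU.isoSpec.hom (add_pow_prime_pow_sections _ p hS0 r),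
          Category.assoc]
    _ = U.ι ≫ powEndo X (p ^ r) hpr (add_pow_prime_pow_sections X p hX r) := by
        rw [IsAffineOpen.isoSpec_hom_fromSpec]
        exact powEndo_comp (p ^ r) hpr _ U.ι _

end Local

/-! ## The Frobenius factor -/

/-- **S1 (Frobenius factor).** For a finite, universally injective, surjective `g : X'' ⟶ X` of
integral schemes with `X` normal, quasi-compact and of characteristic `p`, some power of the
absolute Frobenius of `X` factors through `g`. [folklore] -/
theorem stub_frobeniusFactor : ∀ (p : ℕ) [Fact p.Prime] (X X'' : Scheme.{0}) [IsIntegral X]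
    [CompactSpace X] [IsIntegral X''] (g : X'' ⟶ X) [IsFinite g] [UniversallyInjective g]
    [Surjective g], (∀ x : X, IsIntegrallyClosed (X.presheaf.stalk x)) →
    ∀ (hX : (p : Γ(X, ⊤)) = 0), ∃ (r : ℕ) (h : X ⟶ X''),
      h ≫ g = powEndo X (p ^ r) (pow_ne_zero r (Fact.out : p.Prime).ne_zero)
        (add_pow_prime_pow_sections X p hX r) := by
  intro p hp X X'' _ _ _ g _ _ _ hN hX
  -- local exponents on all non-empty affine opens
  choose N hNσ using fun U : {U : X.affineOpens // Nonempty (U : X.Opens)} =>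
    haveI := U.2; exists_frobeniusFactor_app_of_le p g hN hX U.1 U.1.2
  -- a finite subcover and a uniform exponent
  obtain ⟨t, ht⟩ := exists_finset_isOpenCover_nonempty_affineOpens X
  choose σ _ hσ using fun i : t => hNσ i.1 (t.sup N) (Finset.le_sup i.2)
  -- the local morphisms
  let 𝒰 := X.openCoverOfIsOpenCover _ ht
  obtain ⟨f, hf⟩ : ∃ f : ∀ i : 𝒰.I₀, 𝒰.X i ⟶ X'', ∀ i, f i ≫ g = 𝒰.f i ≫
      powEndo X (p ^ t.sup N) (pow_ne_zero _ hp.out.ne_zero)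
        (add_pow_prime_pow_sections X p hX _) :=
    ⟨fun (i : t) => i.1.1.2.isoSpec.hom ≫ Spec.map (CommRingCat.ofHom (σ i)) ≫
        (i.1.1.2.preimage g).isoSpec.inv ≫ (g ⁻¹ᵁ (i.1.1 : X.Opens)).ι,
      fun (i : t) => isoSpec_SpecMap_comp_eq p g hX (t.sup N) (i.1.1 : X.Opens) i.1.1.2 (σ i)
        (hσ i)⟩
  -- glue
  refine ⟨t.sup N, 𝒰.glueMorphisms f fun i j => ?_, ?_⟩
  · haveI : IsReduced (pullback (𝒰.f i) (𝒰.f j)) :=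
      isReduced_of_isOpenImmersion (pullback.fst (𝒰.f i) (𝒰.f j))
    apply hom_eq_of_comp_eq_of_universallyInjective g
    rw [Category.assoc, Category.assoc, hf, hf, ← Category.assoc, pullback.condition,
      Category.assoc]
  · refine 𝒰.hom_ext _ _ fun i => ?_
    rw [Scheme.Cover.ι_glueMorphisms_assoc]
    exact hf i

end Summit.ResolutionOfSingularities.ResolutionOfSingularities.Theorems

end
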